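import Summits.Ventures.HodgeKum4.Theorems.KummerFixedLocusH3Assembly
import HarnessLib

/-!
# Crux I from its Kummer-point instance and COHOMOLOGICAL transport (cell `hodge-kum4`, seat p2)

HONEST FRAMING.  Nothing here proves I1geo, crux I, L3° or the Hodge conjecture.  This file offers
the planner a BOOKING OPTION for the one non-print residual of route `KummerFixedLocus`
(I1geo = `Kum4FixedFourfoldMeetsTranslates`, `@[conjecture]`, stated for EVERY `X` of `Kum⁴`-type):
the residual may be restricted to the generalized Kummer varieties `K⁴(A)` themselves (explicit
algebraic varieties — no deformation theory), provided the tree carries ONE purely cohomological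
transport statement (a synthesis of printed theorems: Hassett–Tschinkel 2013 Thm. 2.1 — `Aut₀` is a
local system acting fibrewise; Floccari 2026 Prop. 4.6 + Lem. 4.2 — the fixed fourfold deforms in a
smooth family and is the unique `4`-dimensional fixed component; Kamenova–Mongardi–Oblomkov 2022
Thm. 4.2 / Cor. 4.4 — `(X, ι)` is a deformation of the pair `(Kⁿ(A), −1)`; Ehresmann/Gauss–Manin
flatness of classes of submanifolds in families): "for every Kummer fixed datum `(ι, W, i)` on `X`
there are a Kummer point `K = K⁴(A)`, a Kummer fixed datum `(ι₀, W₀, i₀)` on `K`, a group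
isomorphism `θ : Γ(K) ≅ Γ(X)` and a `θ`-equivariant linear isomorphism `P : H⁸(K(ℂ); ℂ) ≅ H⁸(X(ℂ); ℂ)`
carrying the Poincaré-dual class of `W₀` to that of `W`".  All hypotheses are stated INLINE (no new
definition is introduced here; naming/booking is the planner's call).  PROVED:
* `kum4FixedFourfoldTranslatesR_at`, `kum4FixedFourfold_gramFunctional_at` — the landed per-`X`
  chain (I1geo at `X` ⇒ I1R at `X` ⇒ the Gram functional `φ = ε'⟨w ∪ ·, [X]⟩` with `φ(ρ(g)w) = 1`,
  `φ(w) ≠ 1`) with the residual taken AT `X` ONLY and the class `w` EXPOSED (the landed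
  `kum4FixedFourfoldClasses_of_facts` hides `w` behind an existential and takes I1geo globally);
* `kum4FixedFourfoldClasses_of_transport` — crux I on every `X` from the Gram functional at Kummer
  points and the cohomological transport (pure linear algebra: `φ := φ₀ ∘ P⁻¹`);
* `kum4FixedFourfoldClasses_of_facts_of_kummerPoint`, `kum4NonInvariantClassesAlgebraic_of_…` — the
  printed facts + André's guarded fact + L1 + transport + I1geo AT KUMMER POINTS ⇒ crux I, L3°;
* `kum4FixedFourfoldMeetsTranslates_atKummerPoints_of` — the restricted residual is implied by I1geo.
-/

noncomputable section

open CategoryTheory MonoidalCategory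
open Literature.AlgebraicTopology.SingularHomology
open Literature.AlgebraicGeometry Literature.AlgebraicGeometry.HodgeTheory
open Literature.AlgebraicGeometry.Hyperkaehler (IsOfGeneralizedKummerType IsGeneralizedKummerVarietyOf
  translationRep translationRepReal Floccari2026_fixedFourfold_kum4Type
  Floccari2026_card_autFixingH2H3_kum4Type Foster2024_translationAction_kum4Type
  GreenKimLazaRobles2022_llvTrivial_isOfHodgeType_kumType GoettscheSoergel1993_chiY_kum4Type
  autFixingH2H3 IsKummerFixedDatum)

namespace Summit.Ventures.HodgeKum4

/-! ### §1 The landed per-`X` chain with the residual at `X` only and the class exposed -/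

/-- **I1R at `X` from I1geo at `X`** (and Fulton's printed intersection-number fact): for a Kummer
fixed datum `(ι, W, i)` on `X` whose `Γ`-translates meet `W` in one reduced point, and the integral
Poincaré dual `w` of `W`, there is `ε' = ±1` with `⟨w_ℂ ∪ ρ(g)w_ℂ, [X(ℂ)]⟩ = ε'` for all `g ≠ 1`.
(Verbatim the landed `kum4FixedFourfoldTranslatesR_of_meetsTranslates`, residual localised at `X`.) -/
theorem kum4FixedFourfoldTranslatesR_at
    (hF : Fulton1998_cupPairing_transversalPoint)
    ⦃X : Motives.SchemeOver ℂ⦄ (hX : Motives.IsSmoothProjective 8 X)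
    (ι : Aut X) ⦃W : Motives.SchemeOver ℂ⦄ (hW : Motives.IsSmoothProjective 4 W) (i : W ⟶ X)
    (hD : IsKummerFixedDatum X ι W i)
    (hgeoX : ∀ g : autFixingH2H3 X, g ≠ 1 →
      ∃ (p q : 𝟙_ (Motives.SchemeOver ℂ) ⟶ W), IsPullback p q i (i ≫ g.val.hom))
    (w : singularCohomology ℤ ℤ (Motives.ComplexPoints X) 8)
    (hw : capProduct (M := ℤ) (rfl : 8 + 8 = 16) w (complexOrientationInt hX).fundamentalClass =
      singularHomology.map ℤ ℤ (Motives.AlgPoints.mapContinuous (L := ℂ) i) 8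
        (complexOrientationInt hW).fundamentalClass) :
    ∃ ε' : ℤ, (ε' = 1 ∨ ε' = -1) ∧ ∀ g : autFixingH2H3 X, g ≠ 1 →
      complexPairingWith X (complexOrientationInt hX)
          (singularCohomology.ringChange (algebraMap ℤ ℂ) (Motives.ComplexPoints X) 8 w)
          (middleRep X g
            (singularCohomology.ringChange (algebraMap ℤ ℂ) (Motives.ComplexPoints X) 8 w)) = ε' := by
  obtain ⟨σ, hσ, hF⟩ := Fulton1998_cupPairing_transversalPoint.dim44 hF
  refine ⟨σ, hσ, fun g hg => ?_⟩
  obtain ⟨p, q, hpq⟩ := hgeoX g hg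
  have hi : AlgebraicGeometry.IsClosedImmersion i.left := hD.isClosedImmersion
  set w' := singularCohomology.map ℤ ℤ (Motives.AlgPoints.mapContinuous (L := ℂ) g.val.inv) 8 w
    with hw'
  have hw'pd := translate_pd hX hW i g.val hw
  have hpair : cupPairing (complexOrientationInt hX) (rfl : 8 + 8 = 16) w w' = σ :=
    hF hX hW hW i (i ≫ g.val.hom) hi (isClosedImmersion_comp_aut i hi g.val) ⟨p, q, hpq⟩ w w' hw hw'pd
  rw [middleRep_ringChange, complexPairingWith_apply, complexFundamentalClass,
    kroneckerPairing_cup_ringChange_complex (rfl : 8 + 8 = 16) (complexOrientationInt hX) w w', hpair]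

/-- **The Gram functional at `X`, class exposed.**  Printed facts (A1 Hirzebruch, Voisin HI/HR,
Göttsche–Soergel, GKLR, Foster, Floccari `|Γ| = 625`, Fulton), A5 (the Kummer involution fixes the
`Γ`-invariant middle classes; a hypothesis, PROVED elsewhere from André's guarded fact + L1) and
I1geo AT `X` give, for a Kummer fixed datum `(ι, W, i)` on `X` and the integral Poincaré dual `w` of
`W`: a functional `φ` (namely `ε'⟨w_ℂ ∪ ·, [X(ℂ)]⟩`) with `φ(ρ(g) w_ℂ) = 1` for `g ≠ 1` and `φ(w_ℂ) ≠ 1`.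
(The landed `kum4FixedFourfoldClasses_of_facts`, localised at `X`, with `w` no longer existential.) -/
theorem kum4FixedFourfold_gramFunctional_at
    (hA1 : Hirzebruch1969_gSignature_involution_halfDimFixedLocus)
    (hHIR : Voisin2002_hodgeIndex_hodgeRiemann_middle)
    (hGS : GoettscheSoergel1993_chiY_kum4Type)
    (hGK : GreenKimLazaRobles2022_llvTrivial_isOfHodgeType_kumType)
    (hF : Foster2024_translationAction_kum4Type)
    (hcardF : Floccari2026_card_autFixingH2H3_kum4Type)
    (hA5 : ∀ ⦃X : Motives.SchemeOver ℂ⦄, Motives.IsSmoothProjective 8 X → IsOfGeneralizedKummerType 4 X →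
      ∀ ι : Aut X, complexBetti.map ι.hom 2 = 𝟙 _ → complexBetti.map ι.hom 3 = -𝟙 _ →
        ∀ c : complexBetti X 8, IsGammaInvariant X c → (complexBetti.map ι.hom 8).hom c = c)
    (hFu : Fulton1998_cupPairing_transversalPoint)
    ⦃X : Motives.SchemeOver ℂ⦄ (hX : Motives.IsSmoothProjective 8 X) (hK : IsOfGeneralizedKummerType 4 X)
    (ι : Aut X) ⦃W : Motives.SchemeOver ℂ⦄ (hW : Motives.IsSmoothProjective 4 W) (i : W ⟶ X)
    (hD : IsKummerFixedDatum X ι W i)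
    (hgeoX : ∀ g : autFixingH2H3 X, g ≠ 1 →
      ∃ (p q : 𝟙_ (Motives.SchemeOver ℂ) ⟶ W), IsPullback p q i (i ≫ g.val.hom))
    (w : singularCohomology ℤ ℤ (Motives.ComplexPoints X) 8)
    (hw : capProduct (M := ℤ) (rfl : 8 + 8 = 16) w (complexOrientationInt hX).fundamentalClass =
      singularHomology.map ℤ ℤ (Motives.AlgPoints.mapContinuous (L := ℂ) i) 8
        (complexOrientationInt hW).fundamentalClass) :
    ∃ φ : complexBetti X 8 →ₗ[ℂ] ℂ,
      (∀ g : autFixingH2H3 X, g ≠ 1 →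
        φ (middleRep X g (singularCohomology.ringChange (algebraMap ℤ ℂ) (Motives.ComplexPoints X) 8 w)) = 1) ∧
      φ (singularCohomology.ringChange (algebraMap ℤ ℂ) (Motives.ComplexPoints X) 8 w) ≠ 1 := by
  obtain ⟨hι2, hιH2, hιH3, hιΓ, -, -, hi, hifix, K, hKf, G, dG, iG, hG, hdG, hiG, hGG, hWG,
    hfixlocus⟩ := id hD
  -- the complex orientations and the Poincaré dual of `W` in real and complex cohomology
  set μ : HomologicalOrientation ℤ (Motives.ComplexPoints X) 16 := complexOrientationInt hX with hμ
  set ν : HomologicalOrientation ℤ (Motives.ComplexPoints W) 8 := complexOrientationInt hW with hν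
  set wR : singularCohomology ℝ ℝ (Motives.ComplexPoints X) 8 :=
    singularCohomology.ringChange (algebraMap ℤ ℝ) (Motives.ComplexPoints X) 8 w with hwR
  set wC : complexBetti X 8 :=
    singularCohomology.ringChange (algebraMap ℤ ℂ) (Motives.ComplexPoints X) 8 w with hwC
  have hwRpd := real_pd_of_int_pd hX hW i hw
  set s : ℤ := cupPairing μ (rfl : 8 + 8 = 16) w w with hs
  -- (A1) the `G`-signature theorem: `Sign(ι, X) = ⟨w_ℝ ∪ w_ℝ, [X]_ℝ⟩ = s`
  have hA1' := hA1.dim8 hX μ ι hι2 Unit K (fun _ => W) G dG (fun _ => hW) hG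
    (fun k => lt_of_le_of_lt (hdG k) (by norm_num)) (fun _ => i) iG (fun _ => hi) hiG
    (fun j j' hjj' => absurd (Subsingleton.elim j j') hjj') hGG (fun _ k => hWG k)
    (by rw [Set.iUnion_const]; exact hfixlocus) (fun _ => ν) (fun _ => wR) (fun _ => hwRpd)
  rw [Fintype.sum_unique] at hA1'
  have hBww : (cupProduct (R := ℝ) (X := Motives.ComplexPoints X) (rfl : 8 + 8 = 16)).compr₂
      ((kroneckerPairing ℝ ℝ (Motives.ComplexPoints X) 16).flip
        (singularHomology.coeffChange (Motives.ComplexPoints X)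
          (algebraMap ℤ ℝ : ℤ →+* ℝ).toAddMonoidHom 16 μ.fundamentalClass)) wR wR = (s : ℝ) :=
    kroneckerPairing_cup_ringChange_real (rfl : 8 + 8 = 16) μ w w
  have hsig : sig ((realPairing X μ).compl₂ (realBetti.map ι.hom 8).hom) = s := by
    have h : ((sig ((realPairing X μ).compl₂ (realBetti.map ι.hom 8).hom) : ℤ) : ℝ) = (s : ℝ) := by
      rw [← hBww, ← hA1', sig]
      push_cast
      rfl
    exact_mod_cast h
  have hself : complexPairingWith X μ wC wC = s := by
    rw [complexPairingWith_apply]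
    exact kroneckerPairing_cup_ringChange_complex (rfl : 8 + 8 = 16) μ w w
  -- (A3) Hodge index / Hodge–Riemann in `ε`-form
  obtain ⟨ε, hε, hHI, hHR⟩ := hHIR.dim8 hX μ
  obtain ⟨A⟩ := nonempty_hodgeModel_holds (n := 8) (X := X) hX
  have hσ : sig (realPairing X μ) = ε * 630 := by
    have h := hHI A
    rw [hGS.signatureSum_eq_fst hX hK A] at h
    exact h
  -- (A4) `ε B > 0` on `𝒦ℝ ∖ 0`
  have hpos : ∀ x ∈ Representation.Coinvariants.ker (middleRepReal X), x ≠ 0 →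
      0 < (ε : ℝ) * realPairing X μ x x := by
    intro x hx hx0
    rw [middleRepReal_eq_lit] at hx
    exact hHR x hx0 (isOfHodgeType_ringChange_of_mem_coinvariantsKer hGK hF hX hK hx)
      (cup_ringChange_eq_zero_of_mem_coinvariantsKer hF hX hK hx)
  -- (A5) `ι^*` fixes the `Γ`-invariant real middle classes
  have hfix : ∀ x ∈ (middleRepReal X).invariants, (realBetti.map ι.hom 8).hom x = x := by
    intro x hx
    refine map_real_eq_self_of_complex ι (hA5 hX hK ι hιH2 hιH3) x fun g hg => ?_
    have h := hx (⟨g, hg⟩⁻¹ : autFixingH2H3 X)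
    rw [middleRepReal_apply, inv_inv] at h
    exact h
  -- (F_Γ) `|Γ| = 625`, odd; `dim 𝒦ℝ ≤ 624`
  have hcard : Nat.card (autFixingH2H3 X) = 625 := hcardF hX hK
  have hodd : Odd (Nat.card (autFixingH2H3 X)) := by rw [hcard]; exact ⟨312, rfl⟩
  have hdim : Module.finrank ℝ (Representation.Coinvariants.ker (middleRepReal X)) ≤ 624 := by
    rw [middleRepReal_eq_lit]
    exact (hF hX hK).2.1
  -- (A0) `Γ` preserves `[X]_ℝ`
  have hμΓ : ∀ g : Aut X, g ∈ autFixingH2H3 X →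
      singularHomology.map ℝ ℝ (Motives.AlgPoints.mapContinuous (L := ℂ) g.hom) 16
        (realFundamentalClass X μ) = realFundamentalClass X μ :=
    fun g hg => map_realFundamentalClass_eq_self_of_odd_card hX (complexOrientationInt hX)
      (autFixingH2H3 X) hodd g hg
  -- `|Sign(ι, X)| ≥ 6`
  have h6 : 6 ≤ |s| := by
    rw [← hsig]
    exact six_le_abs_kum4_gSignature hX μ ι hι2 hιΓ (cupProduct_gradedComm_holds ℝ (Motives.ComplexPoints X))
      hμΓ hcard hdim ε hε hpos hfix hσ
  -- (I1R) at `X`, on the datum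
  obtain ⟨ε', hε', hI1'⟩ := kum4FixedFourfoldTranslatesR_at hFu hX ι hW i hD hgeoX w hw
  -- the functional `φ = ε'⟨w_ℂ ∪ ·, [X(ℂ)]⟩`
  refine ⟨(ε' : ℂ) • complexPairingWith X μ wC, fun g hg => ?_, ?_⟩
  · rw [LinearMap.smul_apply, hI1' g hg, smul_eq_mul]
    rcases hε' with rfl | rfl <;> norm_num
  · rw [LinearMap.smul_apply, hself, smul_eq_mul]
    intro h
    have h' : (ε' : ℤ) * s = 1 := by exact_mod_cast h
    rcases hε' with rfl | rfl
    · rw [one_mul] at h'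
      rw [h'] at h6
      norm_num at h6
    · rw [neg_one_mul] at h'
      have : s = -1 := by omega
      rw [this] at h6
      norm_num at h6

/-! ### §2 Crux I from the Kummer point and cohomological transport -/

/-- **Crux I on every `X` from the Gram functional at Kummer points and COHOMOLOGICAL transport.**
Hypotheses (inline, no new definition): `hA2` Floccari's fixed-fourfold fact (a datum exists on
every `X`); `hT` the transport — for every datum `(ι, W, i)` on `X` and the integral Poincaré dual
`w` of `W` there are an abelian surface `A`, a smooth projective generalized Kummer variety `K` of
`A` (`IsGeneralizedKummerVarietyOf 4 A K`), a datum `(ι₀, W₀, i₀)` on `K` with Poincaré dual `w₀`,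
a group isomorphism `θ : Γ(K) ≅ Γ(X)` and a `θ`-equivariant linear isomorphism
`P : H⁸(K(ℂ); ℂ) ≅ H⁸(X(ℂ); ℂ)` with `P (w₀)_ℂ = w_ℂ` (printed synthesis: Hassett–Tschinkel 2013
Thm. 2.1, Floccari 2026 Prop. 4.6 / Lem. 4.2, KMO 2022 Cor. 4.4, Gauss–Manin); `hI₀` the Gram
functional at every Kummer point.  Then `Kum4FixedFourfoldClasses` (crux I) holds — with
`w := w_ℂ` (algebraic: Poincaré dual of a fourfold) and `φ := φ₀ ∘ P⁻¹`. -/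
theorem kum4FixedFourfoldClasses_of_transport
    (hA2 : Floccari2026_fixedFourfold_kum4Type)
    (hT : ∀ ⦃X : Motives.SchemeOver ℂ⦄ (hX : Motives.IsSmoothProjective 8 X), IsOfGeneralizedKummerType 4 X →
      ∀ (ι : Aut X) ⦃W : Motives.SchemeOver ℂ⦄ (hW : Motives.IsSmoothProjective 4 W) (i : W ⟶ X),
        IsKummerFixedDatum X ι W i →
        ∀ (w : singularCohomology ℤ ℤ (Motives.ComplexPoints X) 8),
          capProduct (M := ℤ) (rfl : 8 + 8 = 16) w (complexOrientationInt hX).fundamentalClass =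
            singularHomology.map ℤ ℤ (Motives.AlgPoints.mapContinuous (L := ℂ) i) 8
              (complexOrientationInt hW).fundamentalClass →
          ∃ (A : Motives.AbelianVariety ℂ) (K : Motives.SchemeOver ℂ)
            (hK8 : Motives.IsSmoothProjective 8 K), A.dim = 2 ∧ IsGeneralizedKummerVarietyOf 4 A K ∧
            ∃ (ι₀ : Aut K) (W₀ : Motives.SchemeOver ℂ) (hW₀ : Motives.IsSmoothProjective 4 W₀)
              (i₀ : W₀ ⟶ K), IsKummerFixedDatum K ι₀ W₀ i₀ ∧
              ∃ (w₀ : singularCohomology ℤ ℤ (Motives.ComplexPoints K) 8),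
                capProduct (M := ℤ) (rfl : 8 + 8 = 16) w₀ (complexOrientationInt hK8).fundamentalClass =
                  singularHomology.map ℤ ℤ (Motives.AlgPoints.mapContinuous (L := ℂ) i₀) 8
                    (complexOrientationInt hW₀).fundamentalClass ∧
                ∃ (θ : autFixingH2H3 K ≃* autFixingH2H3 X) (P : complexBetti K 8 ≃ₗ[ℂ] complexBetti X 8),
                  (∀ (g : autFixingH2H3 K) (c : complexBetti K 8),
                    P (middleRep K g c) = middleRep X (θ g) (P c)) ∧
                  P (singularCohomology.ringChange (algebraMap ℤ ℂ) (Motives.ComplexPoints K) 8 w₀) =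
                    singularCohomology.ringChange (algebraMap ℤ ℂ) (Motives.ComplexPoints X) 8 w)
    (hI₀ : ∀ ⦃A : Motives.AbelianVariety ℂ⦄ ⦃K : Motives.SchemeOver ℂ⦄ (hK8 : Motives.IsSmoothProjective 8 K),
      A.dim = 2 → IsGeneralizedKummerVarietyOf 4 A K →
      ∀ (ι₀ : Aut K) ⦃W₀ : Motives.SchemeOver ℂ⦄ (hW₀ : Motives.IsSmoothProjective 4 W₀) (i₀ : W₀ ⟶ K),
        IsKummerFixedDatum K ι₀ W₀ i₀ →
        ∀ (w₀ : singularCohomology ℤ ℤ (Motives.ComplexPoints K) 8),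
          capProduct (M := ℤ) (rfl : 8 + 8 = 16) w₀ (complexOrientationInt hK8).fundamentalClass =
            singularHomology.map ℤ ℤ (Motives.AlgPoints.mapContinuous (L := ℂ) i₀) 8
              (complexOrientationInt hW₀).fundamentalClass →
          ∃ φ₀ : complexBetti K 8 →ₗ[ℂ] ℂ,
            (∀ g : autFixingH2H3 K, g ≠ 1 →
              φ₀ (middleRep K g
                (singularCohomology.ringChange (algebraMap ℤ ℂ) (Motives.ComplexPoints K) 8 w₀)) = 1) ∧
            φ₀ (singularCohomology.ringChange (algebraMap ℤ ℂ) (Motives.ComplexPoints K) 8 w₀) ≠ 1) :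
    Summit.Ventures.HodgeKum4.Kum4FixedFourfoldClasses := by
  intro X hX hK
  -- a datum on `X`, the Poincaré dual of its fourfold, algebraic
  obtain ⟨ι, W, i, hD'⟩ := hA2 hX hK
  have hD : IsKummerFixedDatum X ι W i := hD'
  have hW : Motives.IsSmoothProjective 4 W := hD.isSmoothProjective
  obtain ⟨w, hw⟩ := exists_int_pdClass hX hW i
  have hwalg := ringChange_int_pdClass_mem_algebraicClasses hX hW i hw
  -- transport from a Kummer point
  obtain ⟨A, K, hK8, hA, hKum, ι₀, W₀, hW₀, i₀, hD₀, w₀, hw₀, θ, P, hP, hPw⟩ := hT hX hK ι hW i hD w hw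
  obtain ⟨φ₀, hφ₀, hφ₀w⟩ := hI₀ hK8 hA hKum ι₀ hW₀ i₀ hD₀ w₀ hw₀
  refine ⟨singularCohomology.ringChange (algebraMap ℤ ℂ) (Motives.ComplexPoints X) 8 w,
    φ₀ ∘ₗ P.symm.toLinearMap, hwalg, fun g hg => ?_, ?_⟩
  · -- `φ₀ (P⁻¹ (ρ_X(g) w_ℂ)) = φ₀ (ρ_K(θ⁻¹ g) (w₀)_ℂ) = 1`
    have hg' : θ.symm g ≠ 1 := by
      intro h
      apply hg
      have := congrArg θ h
      simpa using this
    have key : middleRep X g (singularCohomology.ringChange (algebraMap ℤ ℂ) (Motives.ComplexPoints X) 8 w) =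
        P (middleRep K (θ.symm g)
          (singularCohomology.ringChange (algebraMap ℤ ℂ) (Motives.ComplexPoints K) 8 w₀)) := by
      rw [hP, MulEquiv.apply_symm_apply, hPw]
    rw [LinearMap.comp_apply, key, LinearEquiv.coe_toLinearMap, LinearEquiv.symm_apply_apply]
    exact hφ₀ _ hg'
  · rw [LinearMap.comp_apply, LinearEquiv.coe_toLinearMap, ← hPw, LinearEquiv.symm_apply_apply]
    exact hφ₀w

/-! ### §3 The restricted residual: I1geo at Kummer points -/

/-- **I1geo at Kummer points is a special case of I1geo** (`K⁴(A)` is of `Kum⁴`-type, the constant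
family: `IsOfGeneralizedKummerType.of_hodgeModel`). -/
theorem kum4FixedFourfoldMeetsTranslates_atKummerPoints_of (hgeo : Kum4FixedFourfoldMeetsTranslates) :
    ∀ ⦃A : Motives.AbelianVariety ℂ⦄ ⦃K : Motives.SchemeOver ℂ⦄, A.dim = 2 →
      IsGeneralizedKummerVarietyOf 4 A K → Motives.IsSmoothProjective 8 K →
      ∀ (ι₀ : Aut K) ⦃W₀ : Motives.SchemeOver ℂ⦄ (i₀ : W₀ ⟶ K), IsKummerFixedDatum K ι₀ W₀ i₀ →
        ∀ g : autFixingH2H3 K, g ≠ 1 →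
          ∃ (p q : 𝟙_ (Motives.SchemeOver ℂ) ⟶ W₀), IsPullback p q i₀ (i₀ ≫ g.val.hom) := by
  intro A K hA hKum hK8 ι₀ W₀ i₀ hD₀ g hg
  obtain ⟨M⟩ := nonempty_hodgeModel_holds (n := 8) (X := K) hK8
  exact hgeo hK8 (IsOfGeneralizedKummerType.of_hodgeModel (n := 4) hA hKum hK8 M) ι₀ i₀ hD₀ g hg

/-! ### §4 The booking option assembled: print + L1 + transport + I1geo at Kummer points ⇒ crux I, L3°, H3 -/

section KummerPointBooking

-- `hT`: the cohomological transport statement (hypothesis of this section; printed synthesis, see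
-- the module docstring).
variable (hT : ∀ ⦃X : Motives.SchemeOver ℂ⦄ (hX : Motives.IsSmoothProjective 8 X), IsOfGeneralizedKummerType 4 X →
      ∀ (ι : Aut X) ⦃W : Motives.SchemeOver ℂ⦄ (hW : Motives.IsSmoothProjective 4 W) (i : W ⟶ X),
        IsKummerFixedDatum X ι W i →
        ∀ (w : singularCohomology ℤ ℤ (Motives.ComplexPoints X) 8),
          capProduct (M := ℤ) (rfl : 8 + 8 = 16) w (complexOrientationInt hX).fundamentalClass =
            singularHomology.map ℤ ℤ (Motives.AlgPoints.mapContinuous (L := ℂ) i) 8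
              (complexOrientationInt hW).fundamentalClass →
          ∃ (A : Motives.AbelianVariety ℂ) (K : Motives.SchemeOver ℂ)
            (hK8 : Motives.IsSmoothProjective 8 K), A.dim = 2 ∧ IsGeneralizedKummerVarietyOf 4 A K ∧
            ∃ (ι₀ : Aut K) (W₀ : Motives.SchemeOver ℂ) (hW₀ : Motives.IsSmoothProjective 4 W₀)
              (i₀ : W₀ ⟶ K), IsKummerFixedDatum K ι₀ W₀ i₀ ∧
              ∃ (w₀ : singularCohomology ℤ ℤ (Motives.ComplexPoints K) 8),
                capProduct (M := ℤ) (rfl : 8 + 8 = 16) w₀ (complexOrientationInt hK8).fundamentalClass =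
                  singularHomology.map ℤ ℤ (Motives.AlgPoints.mapContinuous (L := ℂ) i₀) 8
                    (complexOrientationInt hW₀).fundamentalClass ∧
                ∃ (θ : autFixingH2H3 K ≃* autFixingH2H3 X) (P : complexBetti K 8 ≃ₗ[ℂ] complexBetti X 8),
                  (∀ (g : autFixingH2H3 K) (c : complexBetti K 8),
                    P (middleRep K g c) = middleRep X (θ g) (P c)) ∧
                  P (singularCohomology.ringChange (algebraMap ℤ ℂ) (Motives.ComplexPoints K) 8 w₀) =
                    singularCohomology.ringChange (algebraMap ℤ ℂ) (Motives.ComplexPoints X) 8 w)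
-- `hgeo₀`: I1geo restricted to the generalized Kummer varieties `K⁴(A)` (hypothesis of this
-- section; the proposed restricted residual).
variable (hgeo₀ : ∀ ⦃A : Motives.AbelianVariety ℂ⦄ ⦃K : Motives.SchemeOver ℂ⦄, A.dim = 2 →
      IsGeneralizedKummerVarietyOf 4 A K → Motives.IsSmoothProjective 8 K →
      ∀ (ι₀ : Aut K) ⦃W₀ : Motives.SchemeOver ℂ⦄ (i₀ : W₀ ⟶ K), IsKummerFixedDatum K ι₀ W₀ i₀ →
        ∀ g : autFixingH2H3 K, g ≠ 1 →
          ∃ (p q : 𝟙_ (Motives.SchemeOver ℂ) ⟶ W₀), IsPullback p q i₀ (i₀ ≫ g.val.hom))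

include hT hgeo₀

/-- **Crux I from print + A5 + cohomological transport + I1geo AT KUMMER POINTS.**  The printed facts
(A1, A2, Voisin HI/HR, Göttsche–Soergel, GKLR, Foster, Floccari `|Γ| = 625`, Fulton), A5 (hypothesis;
proved from André + L1 in `KummerFixedLocusInvolutionParity`), the transport statement `hT` and
I1geo restricted to the generalized Kummer varieties `K⁴(A)` imply `Kum4FixedFourfoldClasses`. -/
theorem kum4FixedFourfoldClasses_of_facts_of_kummerPoint
    (hA1 : Hirzebruch1969_gSignature_involution_halfDimFixedLocus)
    (hA2 : Floccari2026_fixedFourfold_kum4Type)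
    (hHIR : Voisin2002_hodgeIndex_hodgeRiemann_middle)
    (hGS : GoettscheSoergel1993_chiY_kum4Type)
    (hGK : GreenKimLazaRobles2022_llvTrivial_isOfHodgeType_kumType)
    (hF : Foster2024_translationAction_kum4Type)
    (hcardF : Floccari2026_card_autFixingH2H3_kum4Type)
    (hA5 : ∀ ⦃X : Motives.SchemeOver ℂ⦄, Motives.IsSmoothProjective 8 X → IsOfGeneralizedKummerType 4 X →
      ∀ ι : Aut X, complexBetti.map ι.hom 2 = 𝟙 _ → complexBetti.map ι.hom 3 = -𝟙 _ →
        ∀ c : complexBetti X 8, IsGammaInvariant X c → (complexBetti.map ι.hom 8).hom c = c)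
    (hFu : Fulton1998_cupPairing_transversalPoint) :
    Summit.Ventures.HodgeKum4.Kum4FixedFourfoldClasses := by
  refine kum4FixedFourfoldClasses_of_transport hA2 hT fun A K hK8 hA hKum ι₀ W₀ hW₀ i₀ hD₀ w₀ hw₀ => ?_
  obtain ⟨M⟩ := nonempty_hodgeModel_holds (n := 8) (X := K) hK8
  have hKK : IsOfGeneralizedKummerType 4 K :=
    IsOfGeneralizedKummerType.of_hodgeModel (n := 4) hA hKum hK8 M
  exact kum4FixedFourfold_gramFunctional_at hA1 hHIR hGS hGK hF hcardF hA5 hFu hK8 hKK ι₀ hW₀ i₀ hD₀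
    (hgeo₀ hA hKum hK8 ι₀ i₀ hD₀) w₀ hw₀

/-- **L3° from print + André's guarded fact + L1 + cohomological transport + I1geo at Kummer points**
(the analogue of the landed `kum4NonInvariantClassesAlgebraic_of_L1_of_meetsTranslates` under the
booking option of this file). -/
theorem kum4NonInvariantClassesAlgebraic_of_L1_of_kummerPoint
    (hA1 : Hirzebruch1969_gSignature_involution_halfDimFixedLocus)
    (hA2 : Floccari2026_fixedFourfold_kum4Type)
    (hHIR : Voisin2002_hodgeIndex_hodgeRiemann_middle)
    (hGS : GoettscheSoergel1993_chiY_kum4Type)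
    (hGK : GreenKimLazaRobles2022_llvTrivial_isOfHodgeType_kumType)
    (hF : Foster2024_translationAction_kum4Type)
    (hcardF : Floccari2026_card_autFixingH2H3_kum4Type)
    (hFu : Fulton1998_cupPairing_transversalPoint)
    (hS1 : Andre1996_dualLefschetz_mem_adjoin_lefschetzInvolution)
    (hL1 : LefschetzGenerationKum4) :
    Summit.Ventures.HodgeKum4.Kum4NonInvariantClassesAlgebraic :=
  kum4NonInvariantClassesAlgebraic_of (kum4TranslationGroup_of_literature hcardF hF)
    (kum4FixedFourfoldClasses_of_facts_of_kummerPoint hT hgeo₀ hA1 hA2 hHIR hGS hGK hF hcardF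
      (kum4InvolutionFixesInvariantMiddleClasses_of hS1 hL1) hFu)

/-- **H3 modulo L1, print, the cohomological transport and I1geo at Kummer points**: the Hodge
conjecture for every smooth projective `Kum⁴`-type eightfold and all its powers (the analogue of the
landed `hc_kum4Type_of_L1_of_meetsTranslates`; eleven REFEREED named facts as hypotheses). -/
theorem hc_kum4Type_of_L1_of_kummerPoint
    (hOGV : Literature.AlgebraicGeometry.Hyperkaehler.OGradyVoisin2022_thirdJacobian_kugaSatake_kummerType)
    (hFF : FloccariFu2026_hodgeClasses_algebraic_powers_discOneWeilFourfold)
    (hFo : Literature.AlgebraicGeometry.Hyperkaehler.Foster2024_lefschetzStandard_kummerType_prime)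
    (hAn : Andre1996_dualLefschetz_mem_adjoin_lefschetzInvolution)
    (hA1 : Hirzebruch1969_gSignature_involution_halfDimFixedLocus)
    (hA2 : Floccari2026_fixedFourfold_kum4Type)
    (hHIR : Voisin2002_hodgeIndex_hodgeRiemann_middle)
    (hGS : GoettscheSoergel1993_chiY_kum4Type)
    (hGK : GreenKimLazaRobles2022_llvTrivial_isOfHodgeType_kumType)
    (hF : Foster2024_translationAction_kum4Type)
    (hcardF : Floccari2026_card_autFixingH2H3_kum4Type)
    (hFu : Fulton1998_cupPairing_transversalPoint)
    (hL1 : LefschetzGenerationKum4) :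
    Summit.Ventures.HodgeKum4.HC_Kum4Type ∧ Summit.Ventures.HodgeKum4.HC_Kum4TypePowers :=
  hc_kum4Type_of_dominated' hL1 (gammaInvariantsDominatedKum4_of_facts hOGV hFF hFo hAn)
    (kum4TranslationGroup_of_literature hcardF hF) (kum4TranslationGroupTrivialOffMiddle_of_literature hF)
    (kum4NonInvariantClassesAlgebraic_of_L1_of_kummerPoint hT hgeo₀ hA1 hA2 hHIR hGS hGK hF hcardF hFu
      hAn hL1)

end KummerPointBooking

end Summit.Ventures.HodgeKum4

end
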